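import Summits.QuantumFields.YangMills.Theses.LogConcaveChart

/-!
# Route `LogConcaveChart`, support item `ChartCovarianceTransfer` (stmt-QuantumFields-26680) — proof

Pure probability (law of total covariance + Cauchy–Schwarz), ideator seat ym-idea-8 g2, LINE 3 of rung R2a:
for bounded measurable `X, Y` on a probability space, a measurable chart `Φ` (σ-algebra `m = σ(Φ)`) and square-integrable
proxies `p, q`,
`|Cov(X,Y) − Cov(p,q)| ≤ ηc + √ηp (√ηq + sq) + sp √ηq`
whenever `|E[Cov(X,Y | m)]| ≤ ηc`, `‖E[X|m] − p‖₂² ≤ ηp`, `‖E[Y|m] − q‖₂² ≤ ηq`, `Var p ≤ sp²`, `Var q ≤ sq²`.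
Proof: `Cov(X,Y) = E[Cov(X,Y|m)] + Cov(P,Q)` with `P = E[X|m]`, `Q = E[Y|m]` (tower property), and
`Cov(P,Q) − Cov(p,q) = Cov(P−p, Q−q) + Cov(P−p, q) + Cov(p, Q−q)` (bilinearity), each bounded by Cauchy–Schwarz
`|Cov(u,v)| ≤ ‖u‖₂ · ‖v − E v‖₂` and `‖v − E v‖₂ ≤ ‖v‖₂`.
No summit, leg or spine crux is proved here; `NT` stays open behind the open cruxes of the route.
-/

set_option autoImplicit false

namespace Summit.QuantumFields.YangMills.Theorems

open MeasureTheory ProbabilityTheory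

section Helpers

variable {Ω : Type*} {mΩ : MeasurableSpace Ω} {μ : Measure Ω}

/-- Cauchy–Schwarz for real integrals in `√`-form. -/
theorem abs_integral_mul_le_sqrt_mul_sqrt {u v : Ω → ℝ} (hu : MemLp u 2 μ) (hv : MemLp v 2 μ) :
    |∫ ω, u ω * v ω ∂μ| ≤ Real.sqrt (∫ ω, (u ω) ^ 2 ∂μ) * Real.sqrt (∫ ω, (v ω) ^ 2 ∂μ) := by
  have h1 : |∫ ω, u ω * v ω ∂μ| ≤ ∫ ω, ‖u ω‖ * ‖v ω‖ ∂μ := by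
    calc |∫ ω, u ω * v ω ∂μ| = ‖∫ ω, u ω * v ω ∂μ‖ := (Real.norm_eq_abs _).symm
      _ ≤ ∫ ω, ‖u ω * v ω‖ ∂μ := norm_integral_le_integral_norm _
      _ = ∫ ω, ‖u ω‖ * ‖v ω‖ ∂μ := by simp_rw [norm_mul]
  have hu' : MemLp u (ENNReal.ofReal 2) μ := by simpa using hu
  have hv' : MemLp v (ENNReal.ofReal 2) μ := by simpa using hv
  have h2 := integral_mul_norm_le_Lp_mul_Lq Real.HolderConjugate.two_two hu' hv'
  have e1 : (∫ ω, ‖u ω‖ ^ (2 : ℝ) ∂μ) = ∫ ω, (u ω) ^ 2 ∂μ := by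
    congr 1; funext ω; rw [Real.rpow_two, Real.norm_eq_abs, sq_abs]
  have e2 : (∫ ω, ‖v ω‖ ^ (2 : ℝ) ∂μ) = ∫ ω, (v ω) ^ 2 ∂μ := by
    congr 1; funext ω; rw [Real.rpow_two, Real.norm_eq_abs, sq_abs]
  rw [e1, e2, ← Real.sqrt_eq_rpow, ← Real.sqrt_eq_rpow] at h2
  exact h1.trans h2

/-- The variance is at most the second moment: `∫ (v − E v)² ≤ ∫ v²`. -/
theorem integral_sub_mean_sq_le [IsProbabilityMeasure μ] {v : Ω → ℝ} (hv : MemLp v 2 μ) :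
    ∫ ω, (v ω - ∫ ω', v ω' ∂μ) ^ 2 ∂μ ≤ ∫ ω, (v ω) ^ 2 ∂μ := by
  have h1 : Var[v; μ] = ∫ ω, (v ω - μ[v]) ^ 2 ∂μ :=
    variance_eq_integral hv.aestronglyMeasurable.aemeasurable
  have h2 : Var[v; μ] = μ[v ^ 2] - μ[v] ^ 2 := variance_eq_sub hv
  have h3 : μ[v ^ 2] = ∫ ω, (v ω) ^ 2 ∂μ := rfl
  rw [← h1, h2, h3]
  nlinarith [sq_nonneg (μ[v])]

/-- Cauchy–Schwarz for the covariance: `|Cov(u,v)| ≤ ‖u‖₂ · ‖v − E v‖₂`. -/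
theorem abs_covariance_le_sqrt [IsProbabilityMeasure μ] {u v : Ω → ℝ} (hu : MemLp u 2 μ) (hv : MemLp v 2 μ) :
    |cov[u, v; μ]| ≤ Real.sqrt (∫ ω, (u ω) ^ 2 ∂μ) * Real.sqrt (∫ ω, (v ω - ∫ ω', v ω' ∂μ) ^ 2 ∂μ) := by
  have hv' : MemLp (fun ω => v ω - ∫ ω', v ω' ∂μ) 2 μ := hv.sub (memLp_const _)
  have hvi : Integrable (fun ω => v ω - ∫ ω', v ω' ∂μ) μ := hv'.integrable one_le_two
  have hint0 : ∫ ω, (v ω - ∫ ω', v ω' ∂μ) ∂μ = 0 := by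
    rw [integral_sub (hv.integrable one_le_two) (integrable_const _), integral_const]
    simp
  have i1 : Integrable (fun ω => u ω * (v ω - ∫ ω', v ω' ∂μ)) μ := hu.integrable_mul hv'
  have i2 : Integrable (fun ω => (∫ ω', u ω' ∂μ) * (v ω - ∫ ω', v ω' ∂μ)) μ := hvi.const_mul _
  have hcov : cov[u, v; μ] = ∫ ω, u ω * (v ω - ∫ ω', v ω' ∂μ) ∂μ := by
    simp only [covariance]
    have e : ∀ ω, (u ω - μ[u]) * (v ω - μ[v]) = u ω * (v ω - μ[v]) - μ[u] * (v ω - μ[v]) :=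
      fun ω => by ring
    simp_rw [e]
    rw [integral_sub i1 i2, integral_const_mul, hint0, mul_zero, sub_zero]
  rw [hcov]
  exact abs_integral_mul_le_sqrt_mul_sqrt hu hv'

end Helpers

open Summit.QuantumFields.YangMills.Theses.LogConcaveChart in
/-- The support item `ChartCovarianceTransfer` of route `LogConcaveChart` (stmt-QuantumFields-26680) holds. -/
theorem logConcaveChart_chartCovarianceTransfer :
    Summit.QuantumFields.YangMills.Theses.LogConcaveChart.ChartCovarianceTransfer := by
  intro Ω mΩ μ hμ n Φ X Y p q M ηc ηp ηq sp sq hΦ hX hY hXb hYb hp hq hηp hηq hsp hsq m h1 h2 h3 h4 h5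
  have hm : m ≤ mΩ := hΦ.comap_le
  -- L² facts for X, Y
  have hXn : ∀ᵐ ω ∂μ, ‖X ω‖ ≤ M := ae_of_all _ (fun ω => by rw [Real.norm_eq_abs]; exact hXb ω)
  have hYn : ∀ᵐ ω ∂μ, ‖Y ω‖ ≤ M := ae_of_all _ (fun ω => by rw [Real.norm_eq_abs]; exact hYb ω)
  have hX2 : MemLp X 2 μ := MemLp.of_bound hX.aestronglyMeasurable M hXn
  have hY2 : MemLp Y 2 μ := MemLp.of_bound hY.aestronglyMeasurable M hYn
  -- the conditional expectations
  set P : Ω → ℝ := μ[X|m] with hPdef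
  set Q : Ω → ℝ := μ[Y|m] with hQdef
  set R : Ω → ℝ := μ[fun ω' => X ω' * Y ω'|m] with hRdef
  have hPbd : ∀ᵐ ω ∂μ, ‖P ω‖ ≤ M := by
    filter_upwards [ae_bdd_abs_condExp_of_ae_bdd_abs (m := m) (μ := μ) (ae_of_all μ hXb)] with ω hω
    rw [Real.norm_eq_abs]; exact hω
  have hQbd : ∀ᵐ ω ∂μ, ‖Q ω‖ ≤ M := by
    filter_upwards [ae_bdd_abs_condExp_of_ae_bdd_abs (m := m) (μ := μ) (ae_of_all μ hYb)] with ω hω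
    rw [Real.norm_eq_abs]; exact hω
  have hP2 : MemLp P 2 μ :=
    MemLp.of_bound ((stronglyMeasurable_condExp (m := m) (μ := μ) (f := X)).mono hm).aestronglyMeasurable
      _ hPbd
  have hQ2 : MemLp Q 2 μ :=
    MemLp.of_bound ((stronglyMeasurable_condExp (m := m) (μ := μ) (f := Y)).mono hm).aestronglyMeasurable
      _ hQbd
  have hR : Integrable R μ := integrable_condExp
  have hPQ : Integrable (fun ω => P ω * Q ω) μ := hP2.integrable_mul hQ2
  -- tower property
  have iP : ∫ ω, P ω ∂μ = ∫ ω, X ω ∂μ := integral_condExp hm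
  have iQ : ∫ ω, Q ω ∂μ = ∫ ω, Y ω ∂μ := integral_condExp hm
  have iR : ∫ ω, R ω ∂μ = ∫ ω, X ω * Y ω ∂μ := integral_condExp hm
  -- law of total covariance
  have ePQ : ∫ ω, (P * Q) ω ∂μ = ∫ ω, P ω * Q ω ∂μ := rfl
  have epq : ∫ ω, (p * q) ω ∂μ = ∫ ω, p ω * q ω ∂μ := rfl
  have cXY : (∫ ω, X ω * Y ω ∂μ) - (∫ ω, X ω ∂μ) * ∫ ω, Y ω ∂μ =
      (∫ ω, (R ω - P ω * Q ω) ∂μ) + cov[P, Q; μ] := by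
    rw [covariance_eq_sub hP2 hQ2, ePQ, integral_sub hR hPQ, iP, iQ, iR]
    ring
  have cpq : (∫ ω, p ω * q ω ∂μ) - (∫ ω, p ω ∂μ) * ∫ ω, q ω ∂μ = cov[p, q; μ] := by
    rw [covariance_eq_sub hp hq, epq]
  -- bilinearity
  have hd1 : MemLp (P - p) 2 μ := hP2.sub hp
  have hd2 : MemLp (Q - q) 2 μ := hQ2.sub hq
  have dec : cov[P, Q; μ] - cov[p, q; μ] =
      cov[P - p, Q - q; μ] + cov[P - p, q; μ] + cov[p, Q - q; μ] := by
    rw [covariance_sub_left hP2 hp hd2, covariance_sub_right hP2 hQ2 hq, covariance_sub_right hp hQ2 hq,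
      covariance_sub_left hP2 hp hq]
    ring
  -- Cauchy–Schwarz bounds
  have s1 : Real.sqrt (∫ ω, ((P - p) ω) ^ 2 ∂μ) ≤ Real.sqrt ηp := by
    apply Real.sqrt_le_sqrt; simpa only [Pi.sub_apply] using h2
  have s2 : Real.sqrt (∫ ω, ((Q - q) ω) ^ 2 ∂μ) ≤ Real.sqrt ηq := by
    apply Real.sqrt_le_sqrt; simpa only [Pi.sub_apply] using h3
  have s2' : Real.sqrt (∫ ω, ((Q - q) ω - ∫ ω', (Q - q) ω' ∂μ) ^ 2 ∂μ) ≤ Real.sqrt ηq :=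
    (Real.sqrt_le_sqrt (integral_sub_mean_sq_le hd2)).trans s2
  have s3 : Real.sqrt (∫ ω, (q ω - ∫ ω', q ω' ∂μ) ^ 2 ∂μ) ≤ sq :=
    (Real.sqrt_le_sqrt h5).trans_eq (Real.sqrt_sq hsq)
  have s4 : Real.sqrt (∫ ω, (p ω - ∫ ω', p ω' ∂μ) ^ 2 ∂μ) ≤ sp :=
    (Real.sqrt_le_sqrt h4).trans_eq (Real.sqrt_sq hsp)
  have b1 : |cov[P - p, Q - q; μ]| ≤ Real.sqrt ηp * Real.sqrt ηq :=
    (abs_covariance_le_sqrt hd1 hd2).trans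
      (mul_le_mul s1 s2' (Real.sqrt_nonneg _) (Real.sqrt_nonneg _))
  have b2 : |cov[P - p, q; μ]| ≤ Real.sqrt ηp * sq :=
    (abs_covariance_le_sqrt hd1 hq).trans (mul_le_mul s1 s3 (Real.sqrt_nonneg _) (Real.sqrt_nonneg _))
  have b3 : |cov[p, Q - q; μ]| ≤ sp * Real.sqrt ηq := by
    rw [covariance_comm]
    calc |cov[Q - q, p; μ]| ≤ Real.sqrt (∫ ω, ((Q - q) ω) ^ 2 ∂μ) *
          Real.sqrt (∫ ω, (p ω - ∫ ω', p ω' ∂μ) ^ 2 ∂μ) := abs_covariance_le_sqrt hd2 hp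
      _ ≤ Real.sqrt ηq * sp := mul_le_mul s2 s4 (Real.sqrt_nonneg _) (Real.sqrt_nonneg _)
      _ = sp * Real.sqrt ηq := mul_comm _ _
  -- conclusion
  rw [cXY, cpq]
  have e : (∫ ω, (R ω - P ω * Q ω) ∂μ) + cov[P, Q; μ] - cov[p, q; μ] =
      (∫ ω, (R ω - P ω * Q ω) ∂μ) + (cov[P - p, Q - q; μ] + cov[P - p, q; μ] + cov[p, Q - q; μ]) := by
    rw [← dec]; ring
  rw [e]
  have t := abs_add_le (∫ ω, (R ω - P ω * Q ω) ∂μ) (cov[P - p, Q - q; μ] + cov[P - p, q; μ] + cov[p, Q - q; μ])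
  have t2 := abs_add_le (cov[P - p, Q - q; μ] + cov[P - p, q; μ]) (cov[p, Q - q; μ])
  have t3 := abs_add_le (cov[P - p, Q - q; μ]) (cov[P - p, q; μ])
  have rhs : ηc + Real.sqrt ηp * (Real.sqrt ηq + sq) + sp * Real.sqrt ηq =
      ηc + Real.sqrt ηp * Real.sqrt ηq + Real.sqrt ηp * sq + sp * Real.sqrt ηq := by ring
  rw [rhs]
  linarith

end Summit.QuantumFields.YangMills.Theorems
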